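import Mathlib

/-!
# Lattice geometry and lattice tail sums (helpers for stub `stub_scaleRegularity`)

Elementary facts used by the scale-regularity stub of line `self-energy-pick-inversion`
(crux stmt-CriticalPhenomena-4799):

* slab coordinates on `ℤ³ = Fin 3 → ℤ`: every point is `insertNth i (±|x_i|) (removeNth i x)`;
  sign-flip invariance of a lattice function makes its slab profiles even and lets one replace
  `x_i` by `|x_i|`; a dominant coordinate exists and controls the Euclidean length
  (`|x_i| ≤ |x|₂ ≤ √3 |x_i|`);
* shell counting on `ℤ²`: the box `[-L,L]²` has `(2L+1)²` points, so the shell `‖y‖∞ = m` has `8m`,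
  and a box sum of `F` with `F ≤ g(m)` on the shell `m` is at most `F 0 + Σ_{m ≤ L} 8 m g(m)`;
  nonnegative lattice sums are bounded by uniform bounds on box sums;
* the one-dimensional tail `Σ_{M < m ≤ L} m^{-q} ≤ M^{1-q}/(q-1)` (`q > 1`, `M ≥ 1`) by comparison with
  `∫ t^{-q}`;
* extraction of two-sided bounds from `S(n) n^{3-η} → c > 0`.

Pure theorem file, no definitions.
-/

noncomputable section

namespace Summit.CriticalPhenomena.Ising3DConformalLimit.Cruxes.DirectCorrelationStableTail.SelfEnergyPickInversion

open MeasureTheory Filter Topology Real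
open scoped BigOperators

/-! ### Slab coordinates on `ℤ³` -/

/-- Updating a transverse coordinate of a slab point updates the transverse part. -/
theorem update_insertNth_succAbove (i : Fin 3) (n : ℤ) (y : Fin 2 → ℤ) (j : Fin 2) (v : ℤ) :
    Function.update (Fin.insertNth i n y : Fin 3 → ℤ) (i.succAbove j) v
      = Fin.insertNth i n (Function.update y j v) := by
  ext l
  refine Fin.succAboveCases i ?_ (fun l' => ?_) l
  · rw [Function.update_of_ne (Fin.succAbove_ne i j).symm, Fin.insertNth_apply_same,
      Fin.insertNth_apply_same]
  · rw [Fin.insertNth_apply_succAbove, Function.update_apply, Function.update_apply,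
      Fin.insertNth_apply_succAbove]
    simp only [Fin.succAbove_right_injective.eq_iff]

/-- Sign-flip invariance makes every slab profile even in the transverse variable. -/
theorem slab_profile_even {a : (Fin 3 → ℤ) → ℝ}
    (hflip : ∀ (j : Fin 3) (x : Fin 3 → ℤ), a (Function.update x j (-x j)) = a x)
    (i : Fin 3) (n : ℤ) (y : Fin 2 → ℤ) :
    a (Fin.insertNth i n (-y)) = a (Fin.insertNth i n y) := by
  set z : Fin 2 → ℤ := Function.update y 0 (-y 0) with hz
  have h1 : -y = Function.update z 1 (-z 1) := by
    ext j; fin_cases j <;> simp [hz]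
  have h2 : a (Fin.insertNth i n z) = a (Fin.insertNth i n y) := by
    have := hflip (i.succAbove 0) (Fin.insertNth i n y)
    rwa [Fin.insertNth_apply_succAbove, update_insertNth_succAbove] at this
  have h3 : a (Fin.insertNth i n (Function.update z 1 (-z 1))) = a (Fin.insertNth i n z) := by
    have := hflip (i.succAbove 1) (Fin.insertNth i n z)
    rwa [Fin.insertNth_apply_succAbove, update_insertNth_succAbove] at this
  rw [h1, h3, h2]

/-- Under sign-flip invariance, `a x = a (insertNth i |x_i| (removeNth i x))`. -/
theorem slab_profile_natAbs {a : (Fin 3 → ℤ) → ℝ}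
    (hflip : ∀ (j : Fin 3) (x : Fin 3 → ℤ), a (Function.update x j (-x j)) = a x)
    (x : Fin 3 → ℤ) (i : Fin 3) :
    a (Fin.insertNth i ((x i).natAbs : ℤ) (Fin.removeNth i x)) = a x := by
  rcases Int.natAbs_eq (x i) with h | h
  · rw [← h, Fin.insertNth_self_removeNth]
  · have h2 : ((x i).natAbs : ℤ) = -x i := by linarith
    rw [h2, Fin.insertNth_removeNth, hflip]

/-- A slab point with `n ≠ 0` in the slab direction is not the origin. -/
theorem insertNth_ne_zero (i : Fin 3) {n : ℤ} (hn : n ≠ 0) (y : Fin 2 → ℤ) :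
    (Fin.insertNth i n y : Fin 3 → ℤ) ≠ 0 := by
  intro h
  have := congrFun h i
  rw [Fin.insertNth_apply_same] at this
  exact hn this

/-- Every lattice point has a dominant coordinate. -/
theorem exists_dominant_coord (x : Fin 3 → ℤ) : ∃ i : Fin 3, ∀ j, |x j| ≤ |x i| := by
  obtain ⟨i, -, hi⟩ := Finset.exists_max_image Finset.univ (fun j => |x j|) Finset.univ_nonempty
  exact ⟨i, fun j => hi j (Finset.mem_univ j)⟩

/-- Each coordinate is bounded by the Euclidean length: `|x_l| ≤ |x|₂`. -/
theorem abs_coord_le_euclid (x : Fin 3 → ℤ) (l : Fin 3) :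
    |(x l : ℝ)| ≤ Real.sqrt (∑ j, ((x j : ℝ)) ^ 2) := by
  refine Real.abs_le_sqrt ?_
  exact Finset.single_le_sum (f := fun j => ((x j : ℝ)) ^ 2) (fun j _ => sq_nonneg _)
    (Finset.mem_univ l)

/-- A dominant coordinate controls the Euclidean length: `|x|₂ ≤ √3 |x_i|`. -/
theorem euclid_le_sqrt_three_mul (x : Fin 3 → ℤ) (i : Fin 3) (hdom : ∀ j, |x j| ≤ |x i|) :
    Real.sqrt (∑ j, ((x j : ℝ)) ^ 2) ≤ Real.sqrt 3 * |(x i : ℝ)| := by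
  have h : ∑ j, ((x j : ℝ)) ^ 2 ≤ 3 * ((x i : ℝ)) ^ 2 := by
    have : ∀ j, ((x j : ℝ)) ^ 2 ≤ ((x i : ℝ)) ^ 2 := fun j => by
      rw [← sq_abs, ← sq_abs (x i : ℝ)]
      have hj : |(x j : ℝ)| ≤ |(x i : ℝ)| := by exact_mod_cast hdom j
      exact pow_le_pow_left₀ (abs_nonneg _) hj 2
    calc ∑ j, ((x j : ℝ)) ^ 2 ≤ ∑ _j : Fin 3, ((x i : ℝ)) ^ 2 := Finset.sum_le_sum fun j _ => this j
      _ = 3 * ((x i : ℝ)) ^ 2 := by simp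
  calc Real.sqrt (∑ j, ((x j : ℝ)) ^ 2) ≤ Real.sqrt (3 * ((x i : ℝ)) ^ 2) := Real.sqrt_le_sqrt h
    _ = Real.sqrt 3 * |(x i : ℝ)| := by rw [Real.sqrt_mul (by norm_num), Real.sqrt_sq_eq_abs]

/-- Coordinates of a difference: `((x - y) j : ℝ) = x j - y j`. -/
theorem cast_sub_apply (x y : Fin 3 → ℤ) (j : Fin 3) :
    (((x - y) j : ℤ) : ℝ) = (x j : ℝ) - (y j : ℝ) := by
  simp

/-- The transverse `ℓ¹` distance is at most twice the Euclidean distance. -/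
theorem transverse_dist_le (x y : Fin 3 → ℤ) (i : Fin 3) :
    ∑ j : Fin 2, |((Fin.removeNth i x j : ℤ) : ℝ) - (Fin.removeNth i y j : ℤ)|
      ≤ 2 * Real.sqrt (∑ j, (((x - y) j : ℝ)) ^ 2) := by
  have h : ∀ j : Fin 2, |((Fin.removeNth i x j : ℤ) : ℝ) - (Fin.removeNth i y j : ℤ)|
      ≤ Real.sqrt (∑ j, (((x - y) j : ℝ)) ^ 2) := fun j => by
    have := abs_coord_le_euclid (x - y) (i.succAbove j)
    rwa [cast_sub_apply] at this
  calc ∑ j : Fin 2, |((Fin.removeNth i x j : ℤ) : ℝ) - (Fin.removeNth i y j : ℤ)|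
      ≤ ∑ _j : Fin 2, Real.sqrt (∑ j, (((x - y) j : ℝ)) ^ 2) := Finset.sum_le_sum fun j _ => h j
    _ = 2 * Real.sqrt (∑ j, (((x - y) j : ℝ)) ^ 2) := by simp [two_mul]

/-! ### The sup norm on `ℤ²` -/

/-- Coordinates are bounded by the sup norm: `|y_j| ≤ ‖y‖`. -/
theorem abs_apply_le_norm (y : Fin 2 → ℤ) (j : Fin 2) : |(y j : ℝ)| ≤ ‖y‖ := by
  have := norm_le_pi_norm y j
  rwa [Int.norm_eq_abs] at this

/-- The sup norm is attained at some coordinate. -/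
theorem exists_norm_eq_abs_apply (y : Fin 2 → ℤ) : ∃ j : Fin 2, ‖y‖ = |(y j : ℝ)| := by
  obtain ⟨j, -, hj⟩ := Finset.exists_max_image Finset.univ (fun j => |(y j : ℝ)|)
    Finset.univ_nonempty
  refine ⟨j, le_antisymm ?_ (abs_apply_le_norm y j)⟩
  rw [pi_norm_le_iff_of_nonneg (abs_nonneg _)]
  intro l
  rw [Int.norm_eq_abs]
  exact hj l (Finset.mem_univ l)

/-- The sup norm of a point of `ℤ²` is `|y_j|` for a coordinate `j` dominating in `natAbs`. -/
theorem norm_eq_natAbs (y : Fin 2 → ℤ) : ∃ j : Fin 2, ‖y‖ = ((y j).natAbs : ℝ) ∧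
    ∀ l, (y l).natAbs ≤ (y j).natAbs := by
  obtain ⟨j, hj⟩ := exists_norm_eq_abs_apply y
  refine ⟨j, by rw [hj, Nat.cast_natAbs, Int.cast_abs], fun l => ?_⟩
  have h := abs_apply_le_norm y l
  rw [hj] at h
  have h' : |y l| ≤ |y j| := by exact_mod_cast h
  have h'' : ((y l).natAbs : ℤ) ≤ (y j).natAbs := by
    rw [Int.natCast_natAbs, Int.natCast_natAbs]; exact h'
  exact_mod_cast h''

/-! ### Boxes and shells in `ℤ²` -/

/-- Membership in the box `[-L, L]²`: all coordinates have `natAbs ≤ L`. -/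
theorem mem_box_iff (L : ℕ) (y : Fin 2 → ℤ) :
    y ∈ Fintype.piFinset (fun _ : Fin 2 => Finset.Icc (-(L : ℤ)) L) ↔ ∀ j, (y j).natAbs ≤ L := by
  rw [Fintype.mem_piFinset]
  refine forall_congr' fun j => ?_
  rw [Finset.mem_Icc, ← abs_le, ← Int.ofNat_le, Int.natCast_natAbs]

/-- The box `[-L, L]²` has `(2L+1)²` points. -/
theorem card_box (L : ℕ) :
    (Fintype.piFinset (fun _ : Fin 2 => Finset.Icc (-(L : ℤ)) L)).card = (2 * L + 1) ^ 2 := by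
  rw [Fintype.card_piFinset, Finset.prod_const, Finset.card_univ, Fintype.card_fin, Int.card_Icc]
  congr 1
  omega

/-- Boxes increase. -/
theorem box_mono (L : ℕ) :
    Fintype.piFinset (fun _ : Fin 2 => Finset.Icc (-(L : ℤ)) L)
      ⊆ Fintype.piFinset (fun _ : Fin 2 => Finset.Icc (-((L + 1 : ℕ) : ℤ)) (L + 1 : ℕ)) :=
  Fintype.piFinset_subset _ _ fun _ => Finset.Icc_subset_Icc (by push_cast; linarith)
    (by push_cast; linarith)

/-- Points of the shell `[-(L+1), L+1]² ∖ [-L, L]²` have sup norm exactly `L + 1`. -/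
theorem mem_shell {L : ℕ} {y : Fin 2 → ℤ}
    (hy : y ∈ Fintype.piFinset (fun _ : Fin 2 => Finset.Icc (-((L + 1 : ℕ) : ℤ)) (L + 1 : ℕ)) \
      Fintype.piFinset (fun _ : Fin 2 => Finset.Icc (-(L : ℤ)) L)) :
    (∀ j, (y j).natAbs ≤ L + 1) ∧ ∃ j, (y j).natAbs = L + 1 := by
  rw [Finset.mem_sdiff, mem_box_iff, mem_box_iff] at hy
  obtain ⟨h1, h2⟩ := hy
  push Not at h2
  obtain ⟨j, hj⟩ := h2
  exact ⟨h1, j, le_antisymm (h1 j) hj⟩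

/-- The shell `‖y‖∞ = L + 1` has `8(L+1)` points. -/
theorem card_shell (L : ℕ) :
    (Fintype.piFinset (fun _ : Fin 2 => Finset.Icc (-((L + 1 : ℕ) : ℤ)) (L + 1 : ℕ)) \
      Fintype.piFinset (fun _ : Fin 2 => Finset.Icc (-(L : ℤ)) L)).card = 8 * (L + 1) := by
  rw [Finset.card_sdiff_of_subset (box_mono L), card_box, card_box]
  have h : (2 * (L + 1) + 1) ^ 2 = 8 * (L + 1) + (2 * L + 1) ^ 2 := by ring
  exact Nat.sub_eq_of_eq_add h

/-- **Shell decomposition of a box sum.** If `F ≤ g(m)` on the shell `‖y‖∞ = m`, then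
`Σ_{[-L,L]²} F ≤ F 0 + Σ_{m < L} 8(m+1) g(m+1)`. -/
theorem sum_box_le_shells (F : (Fin 2 → ℤ) → ℝ) (g : ℕ → ℝ)
    (hg : ∀ (y : Fin 2 → ℤ) (m : ℕ), (∀ j, (y j).natAbs ≤ m) → (∃ j, (y j).natAbs = m) → F y ≤ g m)
    (L : ℕ) :
    ∑ y ∈ Fintype.piFinset (fun _ : Fin 2 => Finset.Icc (-(L : ℤ)) L), F y
      ≤ F 0 + ∑ m ∈ Finset.range L, 8 * ((m : ℝ) + 1) * g (m + 1) := by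
  induction L with
  | zero =>
    rw [Finset.sum_range_zero, add_zero, Finset.sum_eq_single_of_mem (0 : Fin 2 → ℤ)]
    · rw [mem_box_iff]; intro j; simp
    · intro y hy hne
      exfalso
      apply hne
      rw [mem_box_iff] at hy
      funext j
      simpa using hy j
  | succ L ih =>
    rw [← Finset.sum_sdiff (box_mono L), Finset.sum_range_succ]
    have hshell : ∑ y ∈ Fintype.piFinset (fun _ : Fin 2 => Finset.Icc (-((L + 1 : ℕ) : ℤ)) (L + 1 : ℕ)) \
        Fintype.piFinset (fun _ : Fin 2 => Finset.Icc (-(L : ℤ)) L), F y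
          ≤ 8 * ((L : ℝ) + 1) * g (L + 1) := by
      refine (Finset.sum_le_card_nsmul _ _ (g (L + 1)) fun y hy => ?_).trans ?_
      · obtain ⟨h1, h2⟩ := mem_shell hy
        exact hg y (L + 1) h1 h2
      · rw [card_shell, nsmul_eq_mul]
        push_cast
        exact le_rfl
    linarith

/-- **Lattice sums from box sums.** A nonnegative function on `ℤ²` whose box sums are bounded by `B`
has `Σ' ≤ B`. -/
theorem tsum_le_of_sum_box_le {F : (Fin 2 → ℤ) → ℝ} (hF : ∀ y, 0 ≤ F y) {B : ℝ} (hB : 0 ≤ B)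
    (h : ∀ L : ℕ, ∑ y ∈ Fintype.piFinset (fun _ : Fin 2 => Finset.Icc (-(L : ℤ)) L), F y ≤ B) :
    ∑' y, F y ≤ B := by
  refine tsum_le_of_sum_le' hB fun s => ?_
  set L : ℕ := s.sup fun y => Finset.univ.sup fun j => (y j).natAbs with hL
  have hsub : s ⊆ Fintype.piFinset (fun _ : Fin 2 => Finset.Icc (-(L : ℤ)) L) := fun y hy => by
    rw [mem_box_iff]
    intro j
    calc (y j).natAbs ≤ Finset.univ.sup (fun j => (y j).natAbs) :=
          Finset.le_sup (f := fun j => (y j).natAbs) (Finset.mem_univ j)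
      _ ≤ L := Finset.le_sup (f := fun y : Fin 2 → ℤ => Finset.univ.sup fun j => (y j).natAbs) hy
  exact (Finset.sum_le_sum_of_subset_of_nonneg hsub fun y _ _ => hF y).trans (h L)

/-! ### One-dimensional tails -/

/-- **Tail of `Σ m^{-q}`**: if `G m ≤ (m+1)^{-q}` for `m ≥ M ≥ 1` and `G m ≤ 0` for `m < M` (`q > 1`), then
`Σ_{m < L} G m ≤ M^{1-q}/(q-1)` for every `L`. -/
theorem sum_range_le_of_tail {q : ℝ} (hq : 1 < q) {M : ℕ} (hM : 1 ≤ M) (G : ℕ → ℝ)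
    (h1 : ∀ m, M ≤ m → G m ≤ (((m : ℝ) + 1) ^ q)⁻¹) (h2 : ∀ m, m < M → G m ≤ 0) (L : ℕ) :
    ∑ m ∈ Finset.range L, G m ≤ ((M : ℝ) ^ (q - 1))⁻¹ / (q - 1) := by
  have hM0 : (0 : ℝ) < M := by exact_mod_cast hM
  have hRHS : 0 ≤ ((M : ℝ) ^ (q - 1))⁻¹ / (q - 1) := by
    have : 0 < q - 1 := by linarith
    positivity
  rcases le_or_gt L M with hLM | hML
  · refine le_trans (Finset.sum_nonpos fun m hm => h2 m ?_) hRHS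
    exact lt_of_lt_of_le (Finset.mem_range.mp hm) hLM
  rw [Finset.range_eq_Ico, ← Finset.sum_Ico_consecutive _ (Nat.zero_le M) hML.le]
  have hhead : ∑ m ∈ Finset.Ico 0 M, G m ≤ 0 :=
    Finset.sum_nonpos fun m hm => h2 m (Finset.mem_Ico.mp hm).2
  have htail : ∑ m ∈ Finset.Ico M L, G m ≤ ((M : ℝ) ^ (q - 1))⁻¹ / (q - 1) := by
    have hanti : AntitoneOn (fun x : ℝ => (x ^ q)⁻¹) (Set.Icc (M : ℝ) L) := by
      intro x hx z hz hxz
      have hx0 : 0 < x := lt_of_lt_of_le hM0 hx.1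
      exact inv_anti₀ (Real.rpow_pos_of_pos hx0 q) (Real.rpow_le_rpow hx0.le hxz (by linarith))
    have hcmp := AntitoneOn.sum_le_integral_Ico hML.le hanti
    have hint : ∫ x in (M : ℝ)..L, (x ^ q)⁻¹ = ((L : ℝ) ^ (-q + 1) - (M : ℝ) ^ (-q + 1)) / (-q + 1) := by
      rw [← integral_rpow (Or.inr ⟨by linarith, ?_⟩)]
      · refine intervalIntegral.integral_congr fun x hx => ?_
        rw [Set.uIcc_of_le (by exact_mod_cast hML.le)] at hx
        exact (Real.rpow_neg (le_of_lt (lt_of_lt_of_le hM0 hx.1)) q).symm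
      · rw [Set.uIcc_of_le (by exact_mod_cast hML.le)]
        intro h0
        linarith [h0.1]
    calc ∑ m ∈ Finset.Ico M L, G m ≤ ∑ m ∈ Finset.Ico M L, ((((m + 1 : ℕ) : ℝ)) ^ q)⁻¹ :=
          Finset.sum_le_sum fun m hm => by
            have := h1 m (Finset.mem_Ico.mp hm).1
            push_cast
            exact this
      _ ≤ ∫ x in (M : ℝ)..L, (x ^ q)⁻¹ := hcmp
      _ = ((L : ℝ) ^ (-q + 1) - (M : ℝ) ^ (-q + 1)) / (-q + 1) := hint
      _ = ((M : ℝ) ^ (-(q - 1)) - (L : ℝ) ^ (-(q - 1))) / (q - 1) := by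
          rw [show -q + 1 = -(q - 1) by ring]
          rw [div_eq_div_iff (by linarith) (by linarith)]
          ring
      _ ≤ (M : ℝ) ^ (-(q - 1)) / (q - 1) := by
          refine div_le_div_of_nonneg_right ?_ (by linarith)
          linarith [Real.rpow_nonneg (Nat.cast_nonneg L) (-(q - 1))]
      _ = ((M : ℝ) ^ (q - 1))⁻¹ / (q - 1) := by rw [Real.rpow_neg hM0.le]
  linarith

/-! ### Two-sided bounds from a positive limit -/

/-- If `u n → c > 0` then eventually `c/2 ≤ u n ≤ 2c`. -/
theorem eventually_two_sided {u : ℕ → ℝ} {c : ℝ} (hc : 0 < c) (h : Tendsto u atTop (nhds c)) :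
    ∃ N : ℕ, ∀ n, N ≤ n → c / 2 ≤ u n ∧ u n ≤ 2 * c := by
  rw [Metric.tendsto_atTop] at h
  obtain ⟨N, hN⟩ := h (c / 2) (by positivity)
  refine ⟨N, fun n hn => ?_⟩
  have := hN n hn
  rw [Real.dist_eq, abs_lt] at this
  constructor <;> linarith [this.1, this.2]

/-- Uniform version over the three directions: if `u i n → c > 0` for every `i : Fin 3`, then there is
one `N` with `c/2 ≤ u i n ≤ 2c` for all `i` and `n ≥ N`. -/
theorem eventually_two_sided_fin3 {u : Fin 3 → ℕ → ℝ} {c : ℝ} (hc : 0 < c)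
    (h : ∀ i, Tendsto (u i) atTop (nhds c)) :
    ∃ N : ℕ, ∀ i n, N ≤ n → c / 2 ≤ u i n ∧ u i n ≤ 2 * c := by
  choose N hN using fun i => eventually_two_sided hc (h i)
  refine ⟨Finset.univ.sup N, fun i n hn => hN i n ?_⟩
  exact le_trans (Finset.le_sup (f := N) (Finset.mem_univ i)) hn

/-! ### Registered helper sub-goal -/

/-- **Registered helper sub-goal `stub_scaleRegularity_auxLattice`** of stub `stub_scaleRegularity`
(line `self-energy-pick-inversion`, crux stmt-CriticalPhenomena-4799): SHELL COUNTING on `ℤ²` — if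
`F ≤ g(m)` on the shell `‖y‖∞ = m`, then `Σ_{y ∈ [-L,L]²} F y ≤ F 0 + Σ_{m < L} 8 (m+1) g(m+1)`
(the shell `‖y‖∞ = m ≥ 1` has exactly `8m` points). -/
theorem stub_scaleRegularity_auxLattice :
    ∀ (F : (Fin 2 → ℤ) → ℝ) (g : ℕ → ℝ), (∀ (y : Fin 2 → ℤ) (m : ℕ), (∀ j, (y j).natAbs ≤ m) →
      (∃ j, (y j).natAbs = m) → F y ≤ g m) → ∀ L : ℕ,
    ∑ y ∈ Fintype.piFinset (fun _ : Fin 2 => Finset.Icc (-(L : ℤ)) L), F y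
      ≤ F 0 + ∑ m ∈ Finset.range L, 8 * ((m : ℝ) + 1) * g (m + 1) :=
  fun F g hg L => sum_box_le_shells F g hg L

end Summit.CriticalPhenomena.Ising3DConformalLimit.Cruxes.DirectCorrelationStableTail.SelfEnergyPickInversion

end
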